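import Summits.BirchSwinnertonDyer.Rank1Residual.ManinAdditive.Gamma1LatticeBalancedCuspDifferencesPrime
import HarnessLib

/-!
# THEOREM B″: `Λ₁(f)` is generated by balanced cusp differences at PRIME conductors `ℓ ≡ −1 (mod 4N)` (es g22 T-es-29 (d))

Summit `BirchSwinnertonDyer`, route `ManinLocalTwoThree` (cell bsd-f2-manin), crux C3 `ManinPrimeToThreeAtNine`
(stmt-BirchSwinnertonDyer-22968).  The variant B″ of the tree's THEOREM B′ (`periodLatticeGamma1_eq_closure_balancedCuspDiffsPrime`,
prime conductors in ONE class `ℓ ≡ ±1 (mod N)`) asked by es (MEMO-es §36.5 (5) / §36.10 T-es-29 (d)): the class can be sharpened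
to `ℓ ≡ −1 (mod 4N)`.  At `3 ∣ N` such `ℓ` satisfy `ℓ ≡ 2 (mod 3)` AND `ℓ ≡ 3 (mod 4)`, so every even character of conductor `ℓ`
has order dividing `(ℓ − 1)/2`, odd and prime to `3` — which is what E-es-87♭⁺ (`OddTameUnitTwistOfPlusIndexPrimeToThree`, odd
order of the unit twist) needs at ODD levels `N` (at `4 ∣ N` it is automatic, tree `oddTameUnitTwistOfPlusIndexPrimeToThree_of_four_dvd`).

* `exists_gamma0_mulT` — right multiplication by `(1 j; 0 1)` keeps the period and moves the second column
  `(b, d) ↦ (aj + b, cj + d)`;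
* `exists_gamma0_lowerRight_mod_four` (Step A) — every `Γ₁(N)`-period is the period of a `Γ₀(N)`-matrix whose lower-right entry is
  `≡ −1 (mod 4N)`: negate (`d ↦ −d ≡ −1 (mod N)`), make `b` odd by the `T`-move (`gcd(a, b) = 1`), then the lower unipotent
  `(1 0; Nk 1)` with `k = −e·b` (`d = −1 + Ne`) gives `d' = −1 + Ne(1 − b²) ≡ −1 (mod 4N)` (`8 ∣ 1 − b²`);
* `cuspSymbol_mem_closure_balancedCuspDiffs_modFour` (Step B) — Dirichlet in the progression `d (mod 4N|b|)`
  (`Nat.forall_exists_prime_gt_and_zmodEq`; `gcd(d, 4Nb) = 1` from the determinant and `d` odd) and the tree's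
  `exists_gamma0_lowerMul` / zero-cycle lemma `exists_modularSymbol_div_eq_zero`, VERBATIM the B′ argument with modulus `4N|b|`;
* `periodLatticeGamma1_le_closure_balancedCuspDiffs_modFour` — **THEOREM B″** (`≤`; the generators are `Γ₁(N)`-periods by the
  tree's `balancedCuspDiffs_subset`, `balancedCuspDiff_modFour_mem_periodLatticeGamma1`).

The generating set is written inline (no new definition).  HONEST FRAMING: elementary (Manin symbols + Dirichlet); nothing about
C3, Manin's conjecture or BSD is proved.  No definitions, no named facts, no sorry.
-/

set_option linter.dupNamespace false
set_option autoImplicit false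

noncomputable section

open scoped MatrixGroups ModularForm

open CongruenceSubgroup Literature.NumberTheory.EllipticCurves
  Literature.NumberTheory.EllipticCurves.ModularForms
  Summit.BirchSwinnertonDyer.Rank1Residual.ManinAdditive.Gamma1Lattice

namespace Summit.BirchSwinnertonDyer.BirchSwinnertonDyer.Theorems.ManinLocalTwoThree

variable {N : ℕ} [NeZero N] (f : CuspForm (Gamma0 N) 2)

/-! ### The `T`-move -/

/-- **Right multiplication by `T^j = (1 j; 0 1)` keeps the period** (`T^j` fixes `∞`, `{∞, T^j∞}_f = 0`) and moves the
second column: `(a b; c d)·(1 j; 0 1) = (a, aj + b; c, cj + d)`. [cite: Manin1972, Prop. 1.4 / Thm. 1.6] -/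
theorem exists_gamma0_mulT (γ : Gamma0 N) (j : ℤ) :
    ∃ γ' : Gamma0 N, ((γ' : SL(2, ℤ)) 0 0 : ℤ) = (γ : SL(2, ℤ)) 0 0 ∧
      ((γ' : SL(2, ℤ)) 0 1 : ℤ) = (γ : SL(2, ℤ)) 0 0 * j + (γ : SL(2, ℤ)) 0 1 ∧
      ((γ' : SL(2, ℤ)) 1 0 : ℤ) = (γ : SL(2, ℤ)) 1 0 ∧
      ((γ' : SL(2, ℤ)) 1 1 : ℤ) = (γ : SL(2, ℤ)) 1 0 * j + (γ : SL(2, ℤ)) 1 1 ∧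
      cuspSymbol f γ' = cuspSymbol f γ := by
  obtain ⟨τ, h00, h01, h10, h11⟩ : ∃ τ : Gamma0 N, ((τ : SL(2, ℤ)) 0 0 : ℤ) = 1 ∧
      ((τ : SL(2, ℤ)) 0 1 : ℤ) = j ∧ ((τ : SL(2, ℤ)) 1 0 : ℤ) = 0 ∧ ((τ : SL(2, ℤ)) 1 1 : ℤ) = 1 := by
    let M : Matrix (Fin 2) (Fin 2) ℤ := !![1, j; 0, 1]
    have hdet : M.det = 1 := by
      rw [Matrix.det_fin_two_of]
      ring
    let τ₀ : SL(2, ℤ) := ⟨M, hdet⟩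
    have hmem : τ₀ ∈ Gamma0 N := by
      rw [Gamma0_mem]
      show (((0 : ℤ)) : ZMod N) = 0
      push_cast
      rfl
    exact ⟨⟨τ₀, hmem⟩, rfl, rfl, rfl, rfl⟩
  refine ⟨γ * τ, ?_, ?_, ?_, ?_, ?_⟩
  · have : (((γ : SL(2, ℤ)) * (τ : SL(2, ℤ))) 0 0 : ℤ) =
        (γ : SL(2, ℤ)) 0 0 * (τ : SL(2, ℤ)) 0 0 + (γ : SL(2, ℤ)) 0 1 * (τ : SL(2, ℤ)) 1 0 := by
      simp [Matrix.mul_apply, Fin.sum_univ_two]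
    rw [Subgroup.coe_mul, this, h00, h10]; ring
  · have : (((γ : SL(2, ℤ)) * (τ : SL(2, ℤ))) 0 1 : ℤ) =
        (γ : SL(2, ℤ)) 0 0 * (τ : SL(2, ℤ)) 0 1 + (γ : SL(2, ℤ)) 0 1 * (τ : SL(2, ℤ)) 1 1 := by
      simp [Matrix.mul_apply, Fin.sum_univ_two]
    rw [Subgroup.coe_mul, this, h01, h11]; ring
  · have : (((γ : SL(2, ℤ)) * (τ : SL(2, ℤ))) 1 0 : ℤ) =
        (γ : SL(2, ℤ)) 1 0 * (τ : SL(2, ℤ)) 0 0 + (γ : SL(2, ℤ)) 1 1 * (τ : SL(2, ℤ)) 1 0 := by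
      simp [Matrix.mul_apply, Fin.sum_univ_two]
    rw [Subgroup.coe_mul, this, h00, h10]; ring
  · have : (((γ : SL(2, ℤ)) * (τ : SL(2, ℤ))) 1 1 : ℤ) =
        (γ : SL(2, ℤ)) 1 0 * (τ : SL(2, ℤ)) 0 1 + (γ : SL(2, ℤ)) 1 1 * (τ : SL(2, ℤ)) 1 1 := by
      simp [Matrix.mul_apply, Fin.sum_univ_two]
    rw [Subgroup.coe_mul, this, h01, h11]; ring
  · rw [cuspSymbol_mul_holds f γ τ]
    have hτ : cuspSymbol f τ = 0 := by
      unfold cuspSymbol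
      rw [if_pos h10]
    rw [hτ, add_zero]

/-! ### Step A: a representative with lower-right entry `≡ −1 (mod 4N)` -/

/-- **Step A of B″.**  Every `Γ₁(N)`-period `{∞, γ∞}_f` is the period of a `Γ₀(N)`-matrix whose lower-right entry is
`≡ −1 (mod 4N)` and whose upper-right entry is odd (negation, `T`-move, lower unipotent move). -/
theorem exists_gamma0_lowerRight_mod_four (γ : Gamma1 N) :
    ∃ γ' : Gamma0 N, (((γ' : SL(2, ℤ)) 1 1 : ℤ) : ZMod (4 * N)) = -1 ∧
      cuspSymbol f γ' = cuspSymbol f ⟨(γ : SL(2, ℤ)), Gamma1_in_Gamma0 N γ.2⟩ := by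
  have hγ1 := (Gamma1_mem N (γ : SL(2, ℤ))).mp γ.2
  -- A1: negate
  have hG0 : (-((γ : SL(2, ℤ)))) ∈ Gamma0 N := by
    have e10 : ((-((γ : SL(2, ℤ)))) 1 0 : ℤ) = -(((γ : SL(2, ℤ))) 1 0) := by
      simp [Matrix.SpecialLinearGroup.coe_neg]
    rw [Gamma0_mem, e10]; push_cast; rw [hγ1.2.2, neg_zero]
  set γ₁ : Gamma0 N := ⟨-((γ : SL(2, ℤ))), hG0⟩ with hγ₁def
  have e00 : ((γ₁ : SL(2, ℤ)) 0 0 : ℤ) = -(((γ : SL(2, ℤ))) 0 0) := by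
    simp [hγ₁def, Matrix.SpecialLinearGroup.coe_neg]
  have e01 : ((γ₁ : SL(2, ℤ)) 0 1 : ℤ) = -(((γ : SL(2, ℤ))) 0 1) := by
    simp [hγ₁def, Matrix.SpecialLinearGroup.coe_neg]
  have e10 : ((γ₁ : SL(2, ℤ)) 1 0 : ℤ) = -(((γ : SL(2, ℤ))) 1 0) := by
    simp [hγ₁def, Matrix.SpecialLinearGroup.coe_neg]
  have e11 : ((γ₁ : SL(2, ℤ)) 1 1 : ℤ) = -(((γ : SL(2, ℤ))) 1 1) := by
    simp [hγ₁def, Matrix.SpecialLinearGroup.coe_neg]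
  have hper₁ : cuspSymbol f γ₁ = cuspSymbol f ⟨(γ : SL(2, ℤ)), Gamma1_in_Gamma0 N γ.2⟩ :=
    cuspSymbol_neg f ⟨(γ : SL(2, ℤ)), Gamma1_in_Gamma0 N γ.2⟩ hG0
  set a₁ : ℤ := (γ₁ : SL(2, ℤ)) 0 0 with ha₁
  set b₁ : ℤ := (γ₁ : SL(2, ℤ)) 0 1 with hb₁
  set c₁ : ℤ := (γ₁ : SL(2, ℤ)) 1 0 with hc₁
  set d₁ : ℤ := (γ₁ : SL(2, ℤ)) 1 1 with hd₁
  have hdet : a₁ * d₁ - b₁ * c₁ = 1 := by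
    have := Matrix.det_fin_two ((γ₁ : SL(2, ℤ)) : Matrix (Fin 2) (Fin 2) ℤ)
    rw [(γ₁ : SL(2, ℤ)).2] at this
    rw [ha₁, hb₁, hc₁, hd₁]; linarith
  have hcN : (N : ℤ) ∣ c₁ := (ZMod.intCast_zmod_eq_zero_iff_dvd _ N).mp (Gamma0_mem.mp γ₁.2)
  have hdN : (N : ℤ) ∣ d₁ + 1 := by
    have h0 : (((-(((γ : SL(2, ℤ))) 1 1 : ℤ) + 1 : ℤ)) : ZMod N) = 0 := by
      push_cast; rw [hγ1.2.1]; ring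
    have := (ZMod.intCast_zmod_eq_zero_iff_dvd _ N).mp h0
    rwa [← e11] at this
  -- A2: choose `j` with `a₁ j + b₁` odd
  obtain ⟨j, hj⟩ : ∃ j : ℤ, Odd (a₁ * j + b₁) := by
    rcases Int.even_or_odd b₁ with he | ho
    · refine ⟨1, ?_⟩
      rw [mul_one]
      have ha : Odd a₁ := by
        have h1 : Odd (a₁ * d₁) := by
          have : a₁ * d₁ = 1 + b₁ * c₁ := by linarith
          rw [this]
          exact odd_one.add_even (he.mul_right _)
        exact (Int.odd_mul.mp h1).1
      exact ha.add_even he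
    · exact ⟨0, by rw [mul_zero, zero_add]; exact ho⟩
  obtain ⟨γ₂, g00, g01, g10, g11, hper₂⟩ := exists_gamma0_mulT f γ₁ j
  rw [← ha₁] at g00
  rw [← ha₁, ← hb₁] at g01
  rw [← hc₁] at g10
  rw [← hc₁, ← hd₁] at g11
  -- `d₂ = c₁ j + d₁ = -1 + N e`
  obtain ⟨e, he⟩ : ∃ e : ℤ, ((γ₂ : SL(2, ℤ)) 1 1 : ℤ) = -1 + N * e := by
    obtain ⟨c', hc'⟩ := hcN
    obtain ⟨d', hd'⟩ := hdN
    exact ⟨c' * j + d', by rw [g11, hc']; linear_combination hd'⟩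
  -- A3: lower unipotent move with `k = -e * b₂`
  obtain ⟨t, ht⟩ := hj
  obtain ⟨γ₃, k01, k11, hper₃⟩ := exists_gamma0_lowerMul f γ₂ (-(e * (a₁ * j + b₁)))
  refine ⟨γ₃, ?_, by rw [hper₃, hper₂, hper₁]⟩
  have hd₃ : ((γ₃ : SL(2, ℤ)) 1 1 : ℤ) + 1 = (4 * N : ℕ) * (-(e * t * (t + 1))) := by
    rw [k11, he, g01, ht]; push_cast; ring
  have h0 : ((((γ₃ : SL(2, ℤ)) 1 1 : ℤ) + 1 : ℤ) : ZMod (4 * N)) = 0 :=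
    (ZMod.intCast_zmod_eq_zero_iff_dvd _ (4 * N)).mpr ⟨_, hd₃⟩
  push_cast at h0
  exact eq_neg_of_add_eq_zero_left h0

/-! ### Step B: Dirichlet in the progression `d (mod 4N|b|)` -/

/-- **Step B of B″.**  A `Γ₀(N)`-matrix with lower-right entry `d ≡ −1 (mod 4N)` has its period among the (closure of the)
balanced cusp differences at PRIME conductors `ℓ > n₀`, `ℓ ≡ −1 (mod 4N)`: Dirichlet along `d + 4N|b|·ℤ`. -/
theorem cuspSymbol_mem_closure_balancedCuspDiffs_modFour (n₀ : ℕ) (δ : Gamma0 N)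
    (hdε : (((δ : SL(2, ℤ)) 1 1 : ℤ) : ZMod (4 * N)) = -1) :
    cuspSymbol f δ ∈ AddSubgroup.closure
      {z : ℂ | ∃ (ℓ : ℕ) (b b' : ℤ), ℓ.Prime ∧ n₀ < ℓ ∧ ((ℓ : ℤ) : ZMod (4 * N)) = -1 ∧
        IsCoprime b ℓ ∧ IsCoprime b' ℓ ∧
        z = modularSymbol f ((b : ℚ) / (ℓ : ℤ)) - modularSymbol f ((b' : ℚ) / (ℓ : ℤ))} := by
  haveI : NeZero (4 * N) := ⟨mul_ne_zero (by norm_num) (NeZero.ne N)⟩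
  set b : ℤ := (δ : SL(2, ℤ)) 0 1 with hb
  set d : ℤ := (δ : SL(2, ℤ)) 1 1 with hd
  have hdet := Matrix.SpecialLinearGroup.det_coe (δ : SL(2, ℤ))
  rw [Matrix.det_fin_two, ← hb, ← hd] at hdet
  obtain ⟨c', hc'⟩ : (N : ℤ) ∣ (δ : SL(2, ℤ)) 1 0 :=
    (ZMod.intCast_zmod_eq_zero_iff_dvd _ N).mp (Gamma0_mem.mp δ.2)
  rw [hc'] at hdet
  -- `4N ∣ d + 1`, hence `N ∣ d + 1` and `d` odd
  have h4N : ((4 * N : ℕ) : ℤ) ∣ d + 1 := by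
    refine (ZMod.intCast_zmod_eq_zero_iff_dvd _ (4 * N)).mp ?_
    push_cast; rw [hdε]; ring
  obtain ⟨m₀, hm₀⟩ := h4N
  push_cast at hm₀
  have hdNε : ((d : ℤ) : ZMod N) = -1 := by
    have h0 : (((d + 1 : ℤ)) : ZMod N) = 0 :=
      (ZMod.intCast_zmod_eq_zero_iff_dvd _ N).mpr ⟨4 * m₀, by rw [hm₀]; ring⟩
    push_cast at h0
    exact eq_neg_of_add_eq_zero_left h0
  have hd0 : d ≠ 0 := by
    intro h0
    rw [h0, zero_add] at hm₀
    have h1 : (4 * (N : ℤ)) ∣ 1 := ⟨m₀, by rw [hm₀]⟩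
    have h2 : 4 * (N : ℤ) ≤ 1 := Int.le_of_dvd one_pos h1
    have h3 := NeZero.pos N
    omega
  by_cases hb0 : b = 0
  · have h0 : cuspSymbol f δ = 0 := by
      rw [cuspSymbol_eq_modularSymbol_div_sub f δ hd0, ← hb, hb0]
      simp
    rw [h0]
    exact zero_mem _
  · -- coprimality of `d` with `4 N b`
    have hcopNb : IsCoprime d ((N : ℤ) * b) :=
      ⟨(δ : SL(2, ℤ)) 0 0, -c', by linear_combination hdet⟩
    have hcopb : IsCoprime d b :=
      ⟨(δ : SL(2, ℤ)) 0 0, -((N : ℤ) * c'), by linear_combination hdet⟩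
    have hcop4 : IsCoprime d 4 := ⟨-1, (N : ℤ) * m₀, by linear_combination -hm₀⟩
    set q : ℕ := 4 * N * b.natAbs with hq
    have hq0 : q ≠ 0 := mul_ne_zero (mul_ne_zero (by norm_num) (NeZero.ne N)) (Int.natAbs_ne_zero.mpr hb0)
    have hqabs : (q : ℤ) = 4 * N * |b| := by rw [hq]; push_cast; ring
    have hqZ : (q : ℤ) = 4 * (N * b) ∨ (q : ℤ) = -(4 * (N * b)) := by
      rcases abs_choice b with h | h
      · left; rw [hqabs, h]; ring
      · right; rw [hqabs, h]; ring
    have hcopq : IsCoprime d (q : ℤ) := by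
      have h4Nb : IsCoprime d (4 * ((N : ℤ) * b)) := hcop4.mul_right hcopNb
      rcases hqZ with h | h
      · rw [h]; exact h4Nb
      · rw [h]; exact h4Nb.neg_right
    obtain ⟨ℓ, hℓn, hℓp, hℓd⟩ := Nat.forall_exists_prime_gt_and_zmodEq (max n₀ 1) hq0 hcopq
    obtain ⟨k, hk⟩ : ∃ k : ℤ, (ℓ : ℤ) = d + N * k * b := by
      obtain ⟨t, ht⟩ := (Int.modEq_iff_dvd.mp hℓd)
      rcases hqZ with h | h
      · exact ⟨-(4 * t), by rw [h] at ht; linear_combination -ht⟩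
      · exact ⟨4 * t, by rw [h] at ht; linear_combination -ht⟩
    obtain ⟨γ', h01', h11', hγ'⟩ := exists_gamma0_lowerMul f δ k
    rw [← hb] at h01'
    rw [← hb, ← hd, ← hk] at h11'
    have hℓ0 : (ℓ : ℤ) ≠ 0 := by exact_mod_cast hℓp.ne_zero
    -- `ℓ ≡ d ≡ -1` modulo `4N` and modulo `N`
    have hℓ4N : ((ℓ : ℤ) : ZMod (4 * N)) = -1 := by
      have hdvd : ((4 * N : ℕ) : ℤ) ∣ (q : ℤ) := by rw [hqabs]; push_cast; exact Dvd.intro _ rfl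
      rw [(ZMod.intCast_eq_intCast_iff _ _ _).mpr (Int.ModEq.of_dvd hdvd hℓd), hdε]
    have hℓN : ((ℓ : ℤ) : ZMod N) = -1 := by
      have hdvd : (N : ℤ) ∣ (q : ℤ) := by rw [hqabs]; exact Dvd.intro (4 * |b|) (by ring)
      rw [(ZMod.intCast_eq_intCast_iff _ _ _).mpr (Int.ModEq.of_dvd hdvd hℓd), hdNε]
    -- the period as a prime-conductor class, and the zero cycle at conductor `ℓ`
    have hper : cuspSymbol f δ = modularSymbol f ((b : ℚ) / (ℓ : ℤ)) - modularSymbol f 0 := by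
      rw [← hγ', cuspSymbol_eq_modularSymbol_div_sub f γ' (by rw [h11']; exact hℓ0), h01', h11']
    obtain ⟨b₀, hb₀, hz⟩ := exists_modularSymbol_div_eq_zero f hℓ0 (Or.inr hℓN)
    have hcopbℓ : IsCoprime b (ℓ : ℤ) := by
      rw [hk]
      exact hcopb.symm.add_mul_right_right ((N : ℤ) * k)
    have hmem : modularSymbol f ((b : ℚ) / (ℓ : ℤ)) - modularSymbol f ((b₀ : ℚ) / (ℓ : ℤ)) ∈
        {z : ℂ | ∃ (ℓ : ℕ) (b b' : ℤ), ℓ.Prime ∧ n₀ < ℓ ∧ ((ℓ : ℤ) : ZMod (4 * N)) = -1 ∧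
          IsCoprime b ℓ ∧ IsCoprime b' ℓ ∧
          z = modularSymbol f ((b : ℚ) / (ℓ : ℤ)) - modularSymbol f ((b' : ℚ) / (ℓ : ℤ))} :=
      ⟨ℓ, b, b₀, hℓp, lt_of_le_of_lt (le_max_left _ _) hℓn, hℓ4N, hcopbℓ, hb₀, rfl⟩
    have : cuspSymbol f δ = modularSymbol f ((b : ℚ) / (ℓ : ℤ)) -
        modularSymbol f ((b₀ : ℚ) / (ℓ : ℤ)) := by rw [hper, hz]
    rw [this]
    exact AddSubgroup.subset_closure hmem

/-! ### THEOREM B″ -/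

/-- **THEOREM B″ (prime conductors in the class `−1 (mod 4N)`).**  For every `N ≥ 1` (`NeZero`) and `n₀`, the `Γ₁(N)`-period
lattice `Λ₁(f)` is contained in the subgroup generated by the balanced cusp differences `{∞, b/ℓ}_f − {∞, b'/ℓ}_f` at PRIME
conductors `ℓ > n₀` with `ℓ ≡ −1 (mod 4N)`. -/
theorem periodLatticeGamma1_le_closure_balancedCuspDiffs_modFour (n₀ : ℕ) :
    periodLatticeGamma1 f ≤ AddSubgroup.closure
      {z : ℂ | ∃ (ℓ : ℕ) (b b' : ℤ), ℓ.Prime ∧ n₀ < ℓ ∧ ((ℓ : ℤ) : ZMod (4 * N)) = -1 ∧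
        IsCoprime b ℓ ∧ IsCoprime b' ℓ ∧
        z = modularSymbol f ((b : ℚ) / (ℓ : ℤ)) - modularSymbol f ((b' : ℚ) / (ℓ : ℤ))} := by
  unfold periodLatticeGamma1
  refine (AddSubgroup.closure_le _).mpr ?_
  rintro _ ⟨γ, rfl⟩
  obtain ⟨γ', hγ', hper⟩ := exists_gamma0_lowerRight_mod_four f γ
  have hmem := cuspSymbol_mem_closure_balancedCuspDiffs_modFour f n₀ γ' hγ'
  rw [hper] at hmem
  exact hmem

/-- The generators of B″ are `Γ₁(N)`-periods (`ℓ ≡ −1 (mod 4N)` gives `ℓ ≡ −1 (mod N)`; tree `balancedCuspDiffs_subset`). -/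
theorem balancedCuspDiff_modFour_mem_periodLatticeGamma1 {ℓ : ℕ} {b b' : ℤ} (hℓ : ℓ.Prime)
    (hℓ4 : ((ℓ : ℤ) : ZMod (4 * N)) = -1) (hb : IsCoprime b ℓ) (hb' : IsCoprime b' ℓ) :
    modularSymbol f ((b : ℚ) / (ℓ : ℤ)) - modularSymbol f ((b' : ℚ) / (ℓ : ℤ)) ∈ periodLatticeGamma1 f := by
  haveI : NeZero (4 * N) := ⟨mul_ne_zero (by norm_num) (NeZero.ne N)⟩
  have hℓN : ((ℓ : ℤ) : ZMod N) = -1 := by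
    have h4N : ((4 * N : ℕ) : ℤ) ∣ (ℓ : ℤ) + 1 := by
      refine (ZMod.intCast_zmod_eq_zero_iff_dvd _ (4 * N)).mp ?_
      push_cast; rw [show ((ℓ : ℕ) : ZMod (4 * N)) = ((ℓ : ℤ) : ZMod (4 * N)) by push_cast; rfl, hℓ4]; ring
    obtain ⟨m₀, hm₀⟩ := h4N
    have h0 : ((((ℓ : ℤ) + 1 : ℤ)) : ZMod N) = 0 :=
      (ZMod.intCast_zmod_eq_zero_iff_dvd _ N).mpr ⟨4 * m₀, by rw [hm₀]; push_cast; ring⟩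
    push_cast at h0 ⊢
    exact eq_neg_of_add_eq_zero_left h0
  exact balancedCuspDiffs_subset f ⟨(ℓ : ℤ), b, b', by exact_mod_cast hℓ.ne_zero, Or.inr hℓN, hb, hb', rfl⟩

end Summit.BirchSwinnertonDyer.BirchSwinnertonDyer.Theorems.ManinLocalTwoThree

end
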